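import Summits.CriticalPhenomena.SAWScalingLimit.Theorems.SAWDefectDecoherencePolygonParitySqueezeDefs
import Summits.CriticalPhenomena.SAWScalingLimit.Theorems.SAWDefectDecoherenceBoundaryClosureRGateFrameRegular
import HarnessLib

/-!
# `BoundaryClosureR` (stmt-CriticalPhenomena-14004), line `polygon-parity-squeeze`, stub
# `stub_gateStability` (GS), part II: the conformal gate density through the reflected frame

Single-domain bookkeeping of the gate-stability theorem.  For a Dobrushin domain `D` flat at
`b = D.pt 1` inside `B(b, s)`, a conformal frame `(Φ, L, L_b)` (`L` a continuous logarithm of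
`Φ'` on `Ω` with limit `L_b` at `b`), a continuous extension `L̄` of `L` to `Ω ∪ gate`, and a
holomorphic `F` on `B(b, s)` equal to `Φ` on the upper half-disc with real positive derivative
along the diameter (the Schwarz reflection of the frame, part I):

* `gateDensity_eq` — ON THE GATE, `L̄(x) − L_b = log (F'(x)/F'(b))` (principal logarithm of a
  positive real): `exp L̄ = F'` on the gate by continuity, `L_b = L̄(b)`, and two continuous
  logarithms of the same function on the (connected) gate segment recentred at `b` agree
  (`Identification.sub_eq_sub_of_exp_eq_mul_exp`).  Hence the conformal gate density
  `exp((5/8)(L̄ − L_b)) = (F'/F'(b))^{5/8}` is canonical (frame- and branch-free);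
* `tendstoUniformlyOn_cexp_mul_clog` — uniform convergence of `q_n → q` on a set where `q` is real
  and pinched in `[μ, M] ⊂ (0, ∞)` gives uniform convergence of `exp(a log q_n) → exp(a log q)`
  (uniform continuity of `w ↦ exp(a log w)` on a compact box in the slit plane).

References: Ahlfors, *Complex Analysis* (1979), Ch. 4 §3.4 (branches of the logarithm);
Pommerenke, *Boundary Behaviour of Conformal Maps* (1992), Thm. 2.6.
-/

noncomputable section

open scoped Topology
open Filter Set Metric Complex
open UpperHalfPlane (upperHalfPlaneSet)
open Literature.Probability.RandomPlanarGeometry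
open Summit.CriticalPhenomena.SAWScalingLimit.Theorems.PickHalfPlane

namespace Summit.CriticalPhenomena.SAWScalingLimit.Theorems.PolygonParitySqueeze.GateStability

/-! ### 1. `exp L̄ = F'` on the gate and `L_b = L̄(b)` -/

/-- **The extended logarithm exponentiates to the reflected derivative on the gate.** If `L` is a
continuous logarithm of `Φ'` on the carrier `Ω` (flat at `b = D.pt 1` in `B(b, s)`), `L̄` a
continuous extension of `L` to `Ω ∪ gate`, and `F` is holomorphic on `B(b, s)` and equal to `Φ` on
the upper half-disc, then `exp (L̄ x) = F'(x)` at every gate point `x` (limits from inside `Ω`,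
where `exp L = Φ' = F'`). [folklore] -/
theorem exp_gateExtension_eq_deriv (D : DobrushinDomain) {s : ℝ}
    (hflat : D.carrier ∩ ball (D.pt 1) s = {z : ℂ | (D.pt 1).im < z.im} ∩ ball (D.pt 1) s)
    {Φ : ConformalEquiv D.carrier upperHalfPlaneSet} {L : ℂ → ℂ}
    (hexp : ∀ z ∈ D.carrier, exp (L z) = deriv Φ z)
    {Lbar : ℂ → ℂ} (hLbar : ContinuousOn Lbar (D.carrier ∪ gateSeg D s))
    (hLbarL : EqOn Lbar L D.carrier)
    {F : ℂ → ℂ} (hFd : DifferentiableOn ℂ F (ball (D.pt 1) s))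
    (hFΦ : EqOn F Φ (D.carrier ∩ ball (D.pt 1) s)) {x : ℂ} (hx : x ∈ gateSeg D s) :
    Tendsto L (𝓝[D.carrier] x) (𝓝 (Lbar x)) ∧ exp (Lbar x) = deriv F x := by
  have hU : IsOpen D.carrier := D.isOpen
  have hxcl : x ∈ closure D.carrier := Identification.mem_closure_of_flat hflat hx.2 hx.1
  haveI : NeBot (𝓝[D.carrier] x) := mem_closure_iff_nhdsWithin_neBot.1 hxcl
  have h1 : Tendsto Lbar (𝓝[D.carrier ∪ gateSeg D s] x) (𝓝 (Lbar x)) := hLbar x (Or.inr hx)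
  have h2 : Tendsto L (𝓝[D.carrier] x) (𝓝 (Lbar x)) :=
    (h1.mono_left (nhdsWithin_mono _ subset_union_left)).congr'
      (eventually_mem_nhdsWithin.mono fun z hz => hLbarL hz)
  refine ⟨h2, ?_⟩
  have h3 : Tendsto (fun z => exp (L z)) (𝓝[D.carrier] x) (𝓝 (exp (Lbar x))) := h2.cexp
  have h4 : Tendsto (deriv F) (𝓝[D.carrier] x) (𝓝 (deriv F x)) :=
    (((hFd.analyticOnNhd isOpen_ball).deriv.continuousOn.continuousAt
      (isOpen_ball.mem_nhds hx.2)).tendsto).mono_left nhdsWithin_le_nhds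
  have hopen : IsOpen (D.carrier ∩ ball (D.pt 1) s) := hU.inter isOpen_ball
  have h5 : (fun z => exp (L z)) =ᶠ[𝓝[D.carrier] x] deriv F := by
    filter_upwards [self_mem_nhdsWithin, mem_nhdsWithin_of_mem_nhds (isOpen_ball.mem_nhds hx.2)]
      with z hz hzb
    rw [hexp z hz]
    have hev : (F : ℂ → ℂ) =ᶠ[𝓝 z] (Φ : ℂ → ℂ) :=
      Filter.eventuallyEq_of_mem (hopen.mem_nhds ⟨hz, hzb⟩) hFΦ
    exact hev.deriv_eq.symm
  exact tendsto_nhds_unique (h3.congr' h5) h4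

/-! ### 2. The gate density through the reflected frame -/

/-- The gate segment `gateSeg D s = {im = im (D.pt 1)} ∩ B(D.pt 1, s)` is preconnected (convex).
[folklore] -/
theorem isPreconnected_gateSeg (D : DobrushinDomain) (s : ℝ) : IsPreconnected (gateSeg D s) := by
  refine (Convex.inter ?_ (convex_ball (D.pt 1) s)).isPreconnected
  have : {z : ℂ | z.im = (D.pt 1).im} =
      {z : ℂ | z.im ≤ (D.pt 1).im} ∩ {z : ℂ | (D.pt 1).im ≤ z.im} := by
    ext z; simp only [mem_setOf_eq, mem_inter_iff]; constructor
    · intro h; exact ⟨h.le, h.ge⟩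
    · rintro ⟨h1, h2⟩; exact le_antisymm h1 h2
  rw [this]
  exact (convex_halfSpace_im_le _).inter (convex_halfSpace_im_ge _)

/-- **The conformal gate density is `(F'/F'(b))^{5/8}`.** With the data of
`exp_gateExtension_eq_deriv`, `0 < s`, the limit `L_b` of `L` at `b = D.pt 1` within `Ω`, and
`F' > 0` real along the diameter, one has `L̄ x − L_b = log (F'(x)/F'(b))` at every gate point `x`
(so `exp((5/8)(L̄ x − L_b)) = exp((5/8) log(F'(x)/F'(b)))`): `L_b = L̄(b)`, and `L̄` and
`log(F'/F'(b)) + log F'(b)` are two continuous logarithms of `F'` on the connected gate segment, so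
their recentred values agree (`Identification.sub_eq_sub_of_exp_eq_mul_exp`).
[cite: PommerenkeBBCM1992, Thm. 2.6] -/
theorem gateDensity_eq (D : DobrushinDomain) {s : ℝ} (hs : 0 < s)
    (hflat : D.carrier ∩ ball (D.pt 1) s = {z : ℂ | (D.pt 1).im < z.im} ∩ ball (D.pt 1) s)
    {Φ : ConformalEquiv D.carrier upperHalfPlaneSet} {L : ℂ → ℂ} {Lb : ℂ}
    (hexp : ∀ z ∈ D.carrier, exp (L z) = deriv Φ z)
    (hLb : Tendsto L (𝓝[D.carrier] (D.pt 1)) (𝓝 Lb))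
    {Lbar : ℂ → ℂ} (hLbar : ContinuousOn Lbar (D.carrier ∪ gateSeg D s))
    (hLbarL : EqOn Lbar L D.carrier)
    {F : ℂ → ℂ} (hFd : DifferentiableOn ℂ F (ball (D.pt 1) s))
    (hFΦ : EqOn F Φ (D.carrier ∩ ball (D.pt 1) s))
    (hpos : ∀ z ∈ ball (D.pt 1) s, z.im = (D.pt 1).im → 0 < (deriv F z).re ∧ (deriv F z).im = 0) :
    ∀ x ∈ gateSeg D s, Lbar x - Lb = Complex.log (deriv F x / deriv F (D.pt 1)) := by
  set b : ℂ := D.pt 1 with hbdef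
  have hbU : b ∈ gateSeg D s := ⟨rfl, mem_ball_self hs⟩
  haveI : NeBot (𝓝[D.carrier] b) := mem_closure_iff_nhdsWithin_neBot.1
    (Identification.mem_closure_of_flat hflat hbU.2 hbU.1)
  -- `L_b = L̄ b`
  have hLbb : Lbar b = Lb :=
    tendsto_nhds_unique (exp_gateExtension_eq_deriv D hflat hexp hLbar hLbarL hFd hFΦ hbU).1 hLb
  -- the derivative along the gate is the positive real `re F'`
  have hreal : ∀ x ∈ gateSeg D s, deriv F x = ((deriv F x).re : ℂ) := fun x hx =>
    Complex.ext (by simp) (by simp [(hpos x hx.2 hx.1).2])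
  have hne : ∀ x ∈ gateSeg D s, deriv F x ≠ 0 := fun x hx h => by
    have := (hpos x hx.2 hx.1).1
    rw [h, zero_re] at this
    exact lt_irrefl _ this
  set c : ℝ := (deriv F b).re with hcdef
  have hc : 0 < c := (hpos b hbU.2 hbU.1).1
  have hcb : (c : ℂ) = deriv F b := (hreal b hbU).symm
  -- the quotient `F'/F'(b)` is a positive real on the gate
  have hquot : ∀ x ∈ gateSeg D s,
      deriv F x / deriv F b = (((deriv F x).re / c : ℝ) : ℂ) ∧ 0 < (deriv F x).re / c := by
    intro x hx
    refine ⟨?_, div_pos (hpos x hx.2 hx.1).1 hc⟩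
    rw [ofReal_div, hcb, ← hreal x hx]
  have hslit : ∀ x ∈ gateSeg D s, deriv F x / deriv F b ∈ slitPlane := fun x hx => by
    rw [(hquot x hx).1]; exact ofReal_mem_slitPlane.2 (hquot x hx).2
  -- the two logarithms
  set L₁ : ℂ → ℂ := fun x => Complex.log (deriv F x / deriv F b) with hL₁def
  have hderc : ContinuousOn (deriv F) (gateSeg D s) :=
    (hFd.analyticOnNhd isOpen_ball).deriv.continuousOn.mono inter_subset_right
  have hL₁ : ContinuousOn L₁ (gateSeg D s) := (hderc.div_const _).clog hslit
  have hL₂ : ContinuousOn Lbar (gateSeg D s) := hLbar.mono subset_union_right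
  have hkey : ∀ x ∈ gateSeg D s, exp (Lbar x) = (c : ℂ) * exp (L₁ x) := by
    intro x hx
    rw [(exp_gateExtension_eq_deriv D hflat hexp hLbar hLbarL hFd hFΦ hx).2, hL₁def]
    simp only
    rw [Complex.exp_log (slitPlane_ne_zero (hslit x hx)), hcb]
    field_simp [hne b hbU]
  have hb₁ : Tendsto L₁ (𝓝[gateSeg D s] b) (𝓝 (L₁ b)) := hL₁ b hbU
  have hb₂ : Tendsto Lbar (𝓝[gateSeg D s] b) (𝓝 (Lbar b)) := hL₂ b hbU
  have hsub := Identification.sub_eq_sub_of_exp_eq_mul_exp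
    (isPreconnected_gateSeg D s) (subset_closure hbU) hL₁ hL₂ hc hkey hb₁ hb₂
  intro x hx
  have h := hsub x hx
  have hL₁b : L₁ b = 0 := by
    simp only [hL₁def, div_self (hne b hbU), Complex.log_one]
  rw [hL₁b, sub_zero, hLbb] at h
  exact h

/-! ### 3. Uniform convergence of `exp(a log q_n)` -/

/-- **Uniform continuity bookkeeping for the `5/8`-power.** If `q_n → q` uniformly on `K`, where
`q` is real on `K` with values in `[μ, M]`, `μ > 0`, then `exp(a log q_n) → exp(a log q)`
uniformly on `K`, for every exponent `a` (eventually the `q_n` take values in the compact box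
`[μ/2, M + μ/2] × [−μ/2, μ/2]` of the slit plane, on which `w ↦ exp(a log w)` is uniformly
continuous). [folklore] -/
theorem tendstoUniformlyOn_cexp_mul_clog {q : ℕ → ℂ → ℂ} {ql : ℂ → ℂ} {K : Set ℂ} {μ M : ℝ}
    (hμ : 0 < μ) (hbd : ∀ x ∈ K, μ ≤ (ql x).re ∧ (ql x).re ≤ M ∧ (ql x).im = 0)
    (h : TendstoUniformlyOn q ql atTop K) (a : ℂ) :
    TendstoUniformlyOn (fun n x => exp (a * Complex.log (q n x)))
      (fun x => exp (a * Complex.log (ql x))) atTop K := by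
  set S : Set ℂ := {w : ℂ | μ / 2 ≤ w.re ∧ w.re ≤ M + μ / 2 ∧ |w.im| ≤ μ / 2} with hSdef
  have hSclosed : IsClosed S := by
    have h1 : IsClosed {w : ℂ | μ / 2 ≤ w.re} := isClosed_le continuous_const continuous_re
    have h2 : IsClosed {w : ℂ | w.re ≤ M + μ / 2} := isClosed_le continuous_re continuous_const
    have h3 : IsClosed {w : ℂ | |w.im| ≤ μ / 2} :=
      isClosed_le (continuous_abs.comp continuous_im) continuous_const
    have : S = {w : ℂ | μ / 2 ≤ w.re} ∩ ({w : ℂ | w.re ≤ M + μ / 2} ∩ {w : ℂ | |w.im| ≤ μ / 2}) := by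
      ext w; simp [hSdef]
    rw [this]
    exact h1.inter (h2.inter h3)
  have hSbdd : Bornology.IsBounded S := by
    refine isBounded_iff_forall_norm_le.2 ⟨|M| + μ, fun w hw => ?_⟩
    obtain ⟨h1, h2, h3⟩ := hw
    calc ‖w‖ ≤ |w.re| + |w.im| := norm_le_abs_re_add_abs_im w
      _ ≤ (|M| + μ / 2) + μ / 2 := by
          gcongr
          rw [abs_le]; constructor
          · linarith [abs_nonneg M]
          · linarith [le_abs_self M]
      _ = |M| + μ := by ring
  have hScpt : IsCompact S := Metric.isCompact_of_isClosed_isBounded hSclosed hSbdd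
  have hSslit : S ⊆ slitPlane := fun w hw => Or.inl (by linarith [hw.1])
  have hg : ContinuousOn (fun w => exp (a * Complex.log w)) S :=
    ((ContinuousOn.clog continuousOn_id hSslit).const_smul a).cexp
  have hgu : UniformContinuousOn (fun w => exp (a * Complex.log w)) S :=
    hScpt.uniformContinuousOn_of_continuous hg
  have hf : ∀ x ∈ K, ql x ∈ S := fun x hx => by
    obtain ⟨h1, h2, h3⟩ := hbd x hx
    exact ⟨by linarith, by linarith, by rw [h3, abs_zero]; linarith⟩
  have hF : ∀ᶠ n in atTop, ∀ x ∈ K, q n x ∈ S := by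
    filter_upwards [(Metric.tendstoUniformlyOn_iff.1 h) (μ / 2) (by positivity)] with n hn x hx
    obtain ⟨h1, h2, h3⟩ := hbd x hx
    have hd := hn x hx
    rw [dist_eq_norm] at hd
    have hre : |(ql x).re - (q n x).re| < μ / 2 :=
      lt_of_le_of_lt (by simpa using abs_re_le_norm (ql x - q n x)) hd
    have him : |(ql x).im - (q n x).im| < μ / 2 :=
      lt_of_le_of_lt (by simpa using abs_im_le_norm (ql x - q n x)) hd
    rw [abs_lt] at hre him
    rw [h3] at him
    refine ⟨by linarith, by linarith, ?_⟩
    rw [abs_le]; constructor <;> linarith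
  exact hgu.comp_tendstoUniformlyOn_eventually hF hf h

/-! ### Registered form -/

/-- **Registered helper `gateStability_gateDensity`** (∀-closed form of `gateDensity_eq`; sub-goal
of stub `stub_gateStability`, crux stmt-CriticalPhenomena-14004, line `polygon-parity-squeeze`):
on the gate, `L̄ − L_b` is the principal logarithm of the normalised reflected derivative
`F'/F'(b)`, so the conformal gate density `exp((5/8)(L̄ − L_b))` is canonical.
[cite: PommerenkeBBCM1992, Thm. 2.6] -/
theorem gateStability_gateDensity : ∀ (D : DobrushinDomain) (s : ℝ), 0 < s → D.carrier ∩ Metric.ball (D.pt 1) s = {z : ℂ | (D.pt 1).im < z.im} ∩ Metric.ball (D.pt 1) s → ∀ (Φ : ConformalEquiv D.carrier UpperHalfPlane.upperHalfPlaneSet) (L : ℂ → ℂ) (Lb : ℂ), (∀ z ∈ D.carrier, Complex.exp (L z) = deriv Φ z) → Filter.Tendsto L (𝓝[D.carrier] (D.pt 1)) (𝓝 Lb) → ∀ (Lbar : ℂ → ℂ), ContinuousOn Lbar (D.carrier ∪ gateSeg D s) → Set.EqOn Lbar L D.carrier → ∀ (F : ℂ → ℂ), DifferentiableOn ℂ F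 (Metric.ball (D.pt 1) s) → Set.EqOn F Φ (D.carrier ∩ Metric.ball (D.pt 1) s) → (∀ z ∈ Metric.ball (D.pt 1) s, z.im = (D.pt 1).im → 0 < (deriv F z).re ∧ (deriv F z).im = 0) → ∀ x ∈ gateSeg D s, Lbar x - Lb = Complex.log (deriv F x / deriv F (D.pt 1)) :=
  fun D _ hs hflat _ _ _ hexp hLb _ hLbar hLbarL _ hFd hFΦ hpos =>
    gateDensity_eq D hs hflat hexp hLb hLbar hLbarL hFd hFΦ hpos

end Summit.CriticalPhenomena.SAWScalingLimit.Theorems.PolygonParitySqueeze.GateStability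

end
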